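import Mathlib
import Summits.RiemannHypothesis.Statement
import Literature.NumberTheory.LFunctions.LiCoefficientArithmeticFormula
import Literature.NumberTheory.LFunctions.BombieriLagariasEtaIdentification
import Literature.NumberTheory.LFunctions.EquivalentsKeiperLiProofs
import Literature.NumberTheory.LFunctions.KeiperLiZeroSum
import Literature.NumberTheory.LFunctions.BombieriLagariasZeroLocation
import Literature.NumberTheory.LFunctions.WeilZeroSum
import HarnessLib
import HarnessLib.Audit

/-!
# RiemannHypothesis / COLUMN 4 (LI) — the L-P(P3) isolation of record: `LiOscDominatesTrend`

LINE 1 — LABEL: `LiOscDominatesTrend` (∀ n ≥ 1, `−λ̄_n ≤ λ̃_n`: Maślanka's oscillating / arithmetic part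
of Li's coefficient dominates minus the trend) is RH-EQUIVALENT·DERIVED, BOTH directions kernel-checked
in this file (`riemannHypothesis_iff_liOscDominatesTrend`): by Coffey's arithmetic formula
`λ_n = λ̄_n + λ̃_n` (`Coffey2005_thm1_holds`, RH-FREE, BombieriLagariasEtaIdentification.lean:701) it is
`∀ n ≥ 1, 0 ≤ λ_n`, and that is RH by Li's criterion (`li_criterion_holds`,
EquivalentsKeiperLiProofs.lean:644). It is the "n-UNIFORM arithmetic lower bound" statement of record of
LADDER-RH §1 rung L-P(P3) (cell rh-crit/dbl RESIDUAL.md v1 §3; director-rh 2026-08-26T01:24:56Z: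
"stays RH-EQUIVALENT in LADDER §1 and is nobody's binder"). The bounded variant — `λ̃_n ≥ −λ̄_n − K`
for all `n ≥ 1` with ONE constant `K` — is ALSO RH-equivalent
(`riemannHypothesis_iff_exists_slack`, via Bombieri–Lagarias Thm. 1 in the
bounded-below form `bombieriLagarias1999_theorem1_pos_of_bddBelow` and
`keiperLiCoeff_eq_tsum_zeros`): additive slack creates NO intermediate rung. bears_on: L-C/L-P
(LADDER-RH §1 COLUMN 4 LI). WHAT THIS IS NOT: not a target, not a route item, not progress on RH —
these are 10-line kernel re-indexings of Li's criterion recorded so that the column's RH-EQUIVALENT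
fence has ONE decl name; the RH-FREE graded family short of it is Freitas' `τ`-ladder
(Freitas 2006 Thm. 1, `τ = 2` RH-free), typed by the cell's Literature modules. Nothing here bears
on the truth of RH.

Filed by rh-crit-dbl-iso (C2 = de Branges + Li corpus) `--supports` the LI column's open assembly item
of route «LiAsymptotic» (custodian rh-li-theory), as a record decl; no second LI residual/route is
opened from the C2 cell (director ruling).
-/

noncomputable section

-- D-0017: `Summit.<S>.<S>.…` is the designed namespace of a single-problem summit.
set_option linter.dupNamespace false

namespace Summit.RiemannHypothesis.RiemannHypothesis.Theorems.LiTheory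

open Literature.NumberTheory.LFunctions
open scoped ComplexConjugate

/-- **L-P(P3) statement of record `LiOscDominatesTrend` — RH-EQUIVALENT·DERIVED (l.1; both
directions proved below):** for every `n ≥ 1`, `−λ̄_n ≤ λ̃_n`, where `λ̄_n = liTrend n =
1 − (n/2)(γ + log π + 2 log 2) + Σ_{j=2}^n (−1)^j C(n,j)(1−2^{−j})ζ(j)` is Maślanka's TREND (the
archimedean part, RH-free and explicit, `~ (n/2) log n + C₁ n`) and `λ̃_n = liOscPart n =
−Σ_{m=1}^n C(n,m) η_{m−1}` the OSCILLATING arithmetic part (Laurent coefficients `η_k` of `−ζ′/ζ` at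
`1`). Equivalent to `∀ n ≥ 1, 0 ≤ λ_n` by Coffey's formula `λ_n = λ̄_n + λ̃_n` and hence to RH by
Li's criterion. Nobody's proving target. [folklore] -/
@[conjecture] def LiOscDominatesTrend : Prop :=
  ∀ n : ℕ, 1 ≤ n → -liTrend n ≤ liOscPart n

/-- Coffey's arithmetic formula turns the statement into Li positivity: `LiOscDominatesTrend ↔
∀ n ≥ 1, 0 ≤ λ_n` (RH-FREE re-indexing; `Coffey2005_thm1_holds`). -/
theorem liOscDominatesTrend_iff_forall_keiperLiCoeff_nonneg :
    LiOscDominatesTrend ↔ ∀ n : ℕ, 1 ≤ n → 0 ≤ keiperLiCoeff n := by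
  refine forall_congr' fun n ↦ forall_congr' fun hn ↦ ?_
  rw [Coffey2005_thm1_holds.2 n hn]
  constructor <;> intro h <;> linarith

/-- **The L-door (RH-FREE theorem about an RH-EQUIVALENT statement): `LiOscDominatesTrend → RH`**
(Li's criterion, sufficiency; `li_criterion_holds`). -/
theorem riemannHypothesis_of_liOscDominatesTrend (h : LiOscDominatesTrend) : _root_.RiemannHypothesis :=
  li_criterion_holds.2 (liOscDominatesTrend_iff_forall_keiperLiCoeff_nonneg.1 h)

/-- The converse (RH-CONSEQUENCE, PROVED): `RH → LiOscDominatesTrend` (Li's criterion, necessity). -/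
theorem liOscDominatesTrend_of_riemannHypothesis (h : _root_.RiemannHypothesis) : LiOscDominatesTrend :=
  liOscDominatesTrend_iff_forall_keiperLiCoeff_nonneg.2 (li_criterion_holds.1 h)

/-- **`RH ↔ LiOscDominatesTrend`** — the L-P(P3) statement of record is RH-EQUIVALENT, both ways
kernel-checked (Li 1997 Thm. 1 + Coffey 2005 Thm. 1, tree theorems). -/
theorem riemannHypothesis_iff_liOscDominatesTrend : _root_.RiemannHypothesis ↔ LiOscDominatesTrend :=
  ⟨liOscDominatesTrend_of_riemannHypothesis, riemannHypothesis_of_liOscDominatesTrend⟩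

/-- Summit-form of the equivalence (`Summit.RiemannHypothesis` is Mathlib's `RiemannHypothesis`). -/
theorem summit_iff_liOscDominatesTrend : Summit.RiemannHypothesis ↔ LiOscDominatesTrend :=
  riemannHypothesis_iff_liOscDominatesTrend

/-- **Additive slack makes no rung: `RH ↔ ∃ K, ∀ n ≥ 1, λ̃_n ≥ −λ̄_n − K`.** `⇒` with `K = 0`;
`⇐`: `λ_n ≥ −K` for all `n` (Coffey), so the absolutely convergent zero sum
`λ_n = Σ'_ρ m(ρ) Re[1 − (1 − 1/ρ)ⁿ]` (`keiperLiCoeff_eq_tsum_zeros`) is bounded below, whence every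
non-trivial zero has `Re ρ ≥ 1/2` (Bombieri–Lagarias 1999 Thm. 1, bounded-below form
`bombieriLagarias1999_theorem1_pos_of_bddBelow`), and the symmetry `ρ ↦ 1 − ρ̄` gives `Re ρ = 1/2`. -/
theorem riemannHypothesis_iff_exists_slack :
    _root_.RiemannHypothesis ↔ ∃ K : ℝ, ∀ n : ℕ, 1 ≤ n → -liTrend n - K ≤ liOscPart n := by
  constructor
  · intro h
    refine ⟨0, fun n hn ↦ ?_⟩
    have := liOscDominatesTrend_of_riemannHypothesis h n hn
    linarith
  · rintro ⟨K, hK⟩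
    -- `keiperLiCoeff n ≥ -K`
    have hlam : ∀ n : ℕ, 1 ≤ n → -K ≤ keiperLiCoeff n := by
      intro n hn
      have h1 := hK n hn
      rw [Coffey2005_thm1_holds.2 n hn]
      linarith
    -- the zero sum is bounded below
    have hsum : ∀ n : ℕ, 1 ≤ n → -K ≤ ∑' ρ : ZetaZeros.riemannZetaNontrivialZeros,
        (((riemannZetaZeroOrder (ρ : ℂ)).toNat : ℕ) : ℝ) * (1 - (1 - 1 / (ρ : ℂ)) ^ n).re := by
      intro n hn
      have h := hlam n hn
      rw [keiperLiCoeff_eq_tsum_zeros hn] at h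
      refine h.trans_eq (tsum_congr fun ρ ↦ ?_)
      have h1 := ZetaZeros.riemannZetaNontrivialZeros.one_le_order ρ.2
      have : (((riemannZetaZeroOrder (ρ : ℂ)).toNat : ℤ)) = riemannZetaZeroOrder (ρ : ℂ) :=
        Int.toNat_of_nonneg (by omega)
      rw [show (((riemannZetaZeroOrder (ρ : ℂ)).toNat : ℕ) : ℝ) = (riemannZetaZeroOrder (ρ : ℂ) : ℝ) by
        exact_mod_cast this]
    have hhalf := bombieriLagarias1999_theorem1_pos_of_bddBelow
      (fun ρ : ZetaZeros.riemannZetaNontrivialZeros ↦ (ρ : ℂ))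
      (fun ρ ↦ (riemannZetaZeroOrder (ρ : ℂ)).toNat)
      (fun ρ ↦ by have := ZetaZeros.riemannZetaNontrivialZeros.one_le_order ρ.2; omega)
      (fun ρ h0 ↦ by
        have := ZetaZeros.riemannZetaNontrivialZeros.re_pos ρ.2
        rw [h0] at this; simp at this)
      (fun ρ ↦ ZetaZeros.riemannZetaNontrivialZeros.ne_one ρ.2)
      summable_weight_zetaZeros hsum
    -- symmetry `ρ ↦ 1 - ρ̄`
    intro s hs htriv _
    have hmem : s ∈ ZetaZeros.riemannZetaNontrivialZeros := ⟨hs, fun ⟨k, hk⟩ ↦ htriv ⟨k, hk.symm⟩⟩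
    have hge := hhalf ⟨s, hmem⟩
    have hle := hhalf ⟨1 - conj s, ZetaZeros.riemannZetaNontrivialZeros.one_sub_conj_mem hmem⟩
    simp only [Complex.sub_re, Complex.one_re, Complex.conj_re] at hle hge
    linarith

end Summit.RiemannHypothesis.RiemannHypothesis.Theorems.LiTheory

end
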